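/-
Copyright (c) 2026 the pub-hodgecm-mathlib formalisation cell (harness21).  Prover seat hodgecm-mathlib-LH4-p07 (g11) (Track A «FOUR-FRAME» free hand routed by the
CHAIR VALVE to L1), Track B «K2-LIT», #184♮ = hLiu418 = stmt-HodgeConjecture-24832; box K2Liu-audit1 (g3) TREE BOX of ★ p863501 (c) «ONE NAMED INSTANCE LINE, no tree
payer yet: `hτ : gramR 1 1 · Tr_{L∕L⁺}(σ·imagUnit L) ≠ 0` … route through the skewness of the transported index».  THE PAYER OF THAT LETTER.
-/
import Literature.NumberTheory.GelbartRogawski1991.LocalKudlaSplittingInjectiveTransported   -- ★ `gramR_eq_diagonal` (+ the CM doubled datum `gramR`, `Fp`)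
import Literature.NumberTheory.GelbartRogawski1991.UnitaryDualPairThetaKernelCM               -- ★ `imagUnit`, `complexConj_imagUnit`, `imagUnit_ne_zero`
import Summits.HodgeConjecture.HodgeConjecture.Theorems.K2LiuSiegelUnipotentFourierDefs           -- ★ Φ1 `skewMatrices`, `mem_skewMatrices_iff` (ED. 2 §4)
import HarnessLib

/-!
# Crux `HLiu418`, socket #41 KIND 1 a♮ — `K2LiuKindOneSingularCornerTraceLetter`: THE CORNER-TRACE LETTER `t₁ · Tr_{L∕L⁺}(σ·δ_L) ≠ 0` FOR AN IMAGINARY `σ ≠ 0`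

Cell `hodgecm-mathlib`, crux item hLiu418 = `stmt-HodgeConjecture-24832`, route `HCCMUnconditional`; squad K2 ∕ K2Liu; desk K2E5-p16 (g8); box K2Liu-audit1 (g3).
THEOREMS ONLY (no `def`, no instance, no notation, no named-fact hypothesis, no `sorry`, default heartbeats); lane `--supports stmt-HodgeConjecture-24832 --as helper`.

THE LETTER.  ★ p863501 `K2LiuKindOneSingularLocalFace.exists_localFace_kindOneSingular`, its good-place twin ★ p863455 `K2LiuKindOneSingularLocalFaceGoodPlace`, and ★
`K2LiuRankOneSingularLocalValueCMRecord` all carry the by-value binder `hτ : gramR L e dV hdV dW hdW 1 1 * Algebra.trace L⁺ L (σ * imagUnit L) ≠ 0` — the local twist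
`τ = t₁ · Tr_{L∕L⁺}(σ·δ_L)` of the corner index `single 1 1 σ` must be non-zero.  The corner entry `σ♭` of a transported rank-one skew-Hermitian index is IMAGINARY (`c σ♭ = −σ♭`,
★ p862643 `conj_index_eq_single` ∕ K2E3-p23's export) and non-zero; for such `σ` the letter holds: `σ·δ_L` is fixed by `c` (product of two imaginary elements), so it lies in
`L⁺` and `Tr_{L∕L⁺}(σ·δ_L) = 2·σ·δ_L ≠ 0` (characteristic `0`), while `t₁ = gramR 1 1 = dV · dW ≠ 0` (the Gram datum is diagonal with non-zero entries, ★ `gramR_eq_diagonal`).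
CAUTION (box K2Liu-audit1 (g3), ★ p863501 (c)): for `σ ∈ L⁺` the letter is FALSE (`Tr(σ·δ_L) = σ·Tr(δ_L) = 0`) — the skewness hypothesis is essential.
* §1 **`trace_mul_imagUnit_ne_zero`** — `σ ≠ 0`, `c σ = −σ` ⟹ `Algebra.trace L⁺ L (σ * imagUnit L) ≠ 0` (any CM field `L`).
* §2 **`gramR_apply_ne_zero`** — the diagonal Gram datum of record has non-zero diagonal entries (`hdV0`, `hdW0`).
* §3 **`cornerTrace_ne_zero`** — the letter `hτ` itself, at the `n = 2` frame of the K1-a♮ line.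
* §4 (ED. 2) **`complexConj_eq_neg_of_single_mem_skewMatrices`** — `single 1 1 σ ∈ Skew_{T_L}(L) ⟹ c σ = −σ` (the payer of `hσ`: ★ `conj_index_mem_skewMatrices` ∘ ★ p862643).
HONEST LABEL.  Elementary field algebra, count-neutral; nothing here closes a socket: `HC_CM` is proved only modulo the 7 printed citations (2 remaining named inputs:
hLiu418 = `stmt-HodgeConjecture-24832`, h413 = `stmt-HodgeConjecture-24833`) until rung 0 closes.

## References
* [Shimura1997] G. Shimura, *Euler Products and Eisenstein Series*, CBMS 93 (1997): §18.1 (18.4) (the local character `ψ(tr(S·X))` of a Hermitian index).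
* [HarrisKudlaSweet1996] M. Harris, S. Kudla, W. J. Sweet, J. AMS 9 (1996): §1 (1.11)–(1.12) (the adapted frame; skew-Hermitian indices).
* [GelbartRogawski1991] S. Gelbart, J. Rogawski, Invent. Math. 105 (1991): §3.1 Prop. 3.1.1 (the CM doubled datum `T = gramR`).
-/

set_option autoImplicit false
set_option linter.dupNamespace false -- the mandated namespace repeats `HodgeConjecture.HodgeConjecture`

noncomputable section

open NumberField
open Literature.NumberTheory.GelbartRogawski1991 Literature.NumberTheory.GelbartRogawski1991.GRConstruction
open Literature.NumberTheory.GelbartRogawski1991.UnitaryDualPair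

namespace Summit.HodgeConjecture.HodgeConjecture.Cruxes.HLiu418.K2LiuKindOneSingularCornerTraceLetter

variable (L : Type) [Field L] [NumberField L] [IsCMField L]

/-! ## §1 The relative trace of `σ·δ_L` for an imaginary `σ ≠ 0` -/

/-- **the product of two imaginary elements is real**: `c σ = −σ`, `c δ = −δ` ⟹ `c (σ·δ) = σ·δ`, i.e. `σ·δ ∈ L⁺` (Mathlib `IsCMField.complexConj_eq_self_iff`).
[cite: HarrisKudlaSweet1996, §1 (1.11)] -/
theorem mul_mem_maximalRealSubfield_of_skew {σ δ : L} (hσ : IsCMField.complexConj L σ = -σ) (hδ : IsCMField.complexConj L δ = -δ) :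
    σ * δ ∈ maximalRealSubfield L := by
  rw [← IsCMField.complexConj_eq_self_iff, map_mul, hσ, hδ, neg_mul_neg]

/-- **`Tr_{L∕L⁺}` of a real element is twice the element**: for `x ∈ L⁺`, `Algebra.trace L⁺ L x = 2 • x` (as elements of `L⁺`; `[L : L⁺] = 2`).
[cite: GelbartRogawski1991, §3.1 Prop. 3.1.1] -/
theorem trace_of_mem_maximalRealSubfield {x : L} (hx : x ∈ maximalRealSubfield L) :
    Algebra.trace (Fp L) L x = 2 • (⟨x, hx⟩ : Fp L) := by
  haveI : Algebra.IsQuadraticExtension (Fp L) L := IsCMField.isQuadraticExtension L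
  have h : x = algebraMap (Fp L) L ⟨x, hx⟩ := rfl
  conv_lhs => rw [h]
  rw [Algebra.trace_algebraMap, Algebra.IsQuadraticExtension.finrank_eq_two (Fp L) L]

/-- **THE RELATIVE TRACE OF `σ·δ_L` IS NON-ZERO FOR AN IMAGINARY `σ ≠ 0`**: `Algebra.trace L⁺ L (σ * imagUnit L) = 2·(σ·δ_L) ≠ 0` (`δ_L = imagUnit L` is imaginary and
non-zero ★ `complexConj_imagUnit`, ★ `imagUnit_ne_zero`; characteristic `0`).  For `σ ∈ L⁺` instead the trace vanishes — the skewness is essential.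
[cite: Shimura1997, §18.1 (18.4)] [cite: HarrisKudlaSweet1996, §1 (1.11)–(1.12)] -/
theorem trace_mul_imagUnit_ne_zero {σ : L} (hσ0 : σ ≠ 0) (hσ : IsCMField.complexConj L σ = -σ) :
    Algebra.trace (Fp L) L (σ * imagUnit L) ≠ 0 := by
  have hmem := mul_mem_maximalRealSubfield_of_skew L hσ (complexConj_imagUnit L)
  rw [trace_of_mem_maximalRealSubfield L hmem]
  refine smul_ne_zero two_ne_zero fun h => ?_
  have h' : σ * imagUnit L = 0 := congrArg Subtype.val h
  exact mul_ne_zero hσ0 (imagUnit_ne_zero L) h'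

/-! ## §2 The diagonal Gram datum of record has non-zero entries -/

section Gram

variable {N M n : ℕ} (e : Fin N × Fin M ≃ Fin n)
  (dV : Fin N → L) (hdV : ∀ i, IsCMField.complexConj L (dV i) = dV i) (hdV0 : ∀ i, dV i ≠ 0)
  (dW : Fin M → L) (hdW : ∀ i, IsCMField.complexConj L (dW i) = dW i) (hdW0 : ∀ i, dW i ≠ 0)

include hdV0 hdW0 in
/-- **`gramR k k ≠ 0`**: the rational Gram matrix of `𝕎 = Res(V ⊗ W)` is `diag(dV_{(e⁻¹k)₁} · dW_{(e⁻¹k)₂})` (★ `gramR_eq_diagonal`) with every `dV i`, `dW j` non-zero.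
[cite: GelbartRogawski1991, §3.1 Prop. 3.1.1] -/
theorem gramR_apply_ne_zero (k : Fin n) : gramR L e dV hdV dW hdW k k ≠ 0 := by
  rw [gramR_eq_diagonal, Matrix.diagonal_apply_eq]
  exact mul_ne_zero (fun h => hdV0 (e.symm k).1 (by simpa using congrArg Subtype.val h))
    (fun h => hdW0 (e.symm k).2 (by simpa using congrArg Subtype.val h))

end Gram

/-! ## §3 The letter `hτ` at the `n = 2` frame of the K1-a♮ line -/

section Corner

variable {N M : ℕ} (e : Fin N × Fin M ≃ Fin 2)
  (dV : Fin N → L) (hdV : ∀ i, IsCMField.complexConj L (dV i) = dV i) (hdV0 : ∀ i, dV i ≠ 0)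
  (dW : Fin M → L) (hdW : ∀ i, IsCMField.complexConj L (dW i) = dW i) (hdW0 : ∀ i, dW i ≠ 0)

include hdV0 hdW0 in
/-- **THE CORNER-TRACE LETTER `hτ` OF ★ p863501 ∕ ★ p863455 ∕ ★ `K2LiuRankOneSingularLocalValueCMRecord`**: for an IMAGINARY non-zero corner entry `σ` (`c σ = −σ` — the (1,1)
entry of a transported rank-one `T_L`-skew index, ★ p862643 `conj_index_eq_single`), `gramR 1 1 · Tr_{L∕L⁺}(σ·δ_L) ≠ 0`; use as
`K2LiuKindOneSingularLocalFace.exists_localFace_kindOneSingular … σ (cornerTrace_ne_zero L e dV hdV hdV0 dW hdW hdW0 hσ0 hσ)`.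
[cite: Shimura1997, §18.1 (18.4)] [cite: HarrisKudlaSweet1996, §1 (1.11)–(1.12)] [cite: GelbartRogawski1991, §3.1 Prop. 3.1.1] -/
theorem cornerTrace_ne_zero {σ : L} (hσ0 : σ ≠ 0) (hσ : IsCMField.complexConj L σ = -σ) :
    gramR L e dV hdV dW hdW 1 1 * Algebra.trace (Fp L) L (σ * imagUnit L) ≠ 0 :=
  mul_ne_zero (gramR_apply_ne_zero L e dV hdV hdV0 dW hdW hdW0 1) (trace_mul_imagUnit_ne_zero L hσ0 hσ)

end Corner

/-! ## §4 (ED. 2) The corner entry of a `T_L`-skew corner index is imaginary — the payer of `hσ` (box K2Liu-audit1 (g3) on ED. 1, note (c)) -/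

section Skew

variable {N M : ℕ} (e : Fin N × Fin M ≃ Fin 2)
  (dV : Fin N → L) (hdV : ∀ i, IsCMField.complexConj L (dV i) = dV i) (hdV0 : ∀ i, dV i ≠ 0)
  (dW : Fin M → L) (hdW : ∀ i, IsCMField.complexConj L (dW i) = dW i) (hdW0 : ∀ i, dW i ≠ 0)

open Summit.HodgeConjecture.HodgeConjecture.Cruxes.HLiu418.K2LiuSiegelUnipotentFourierDefs

include hdV0 hdW0 in
/-- **THE CORNER ENTRY OF A `T_L`-SKEW CORNER INDEX IS IMAGINARY.**  If `single 1 1 σ ∈ Skew_{T_L}(L)` (`T_L = gramR ⊗ L`; e.g. the transported rank-one index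
`D₀·S·g⁻¹ = single 1 1 σ` of ★ p862643 `exists_corner_index_whittakerDelta_eq`, skew by ★ `conj_index_mem_skewMatrices` with `hrel`), then `c σ = −σ`: the `(1,1)` entry of
`T_L·X + c(X)ᵀ·T_L = 0` at `X = single 1 1 σ` reads `t₁·σ + c(σ)·t₁ = 0` and `t₁ = gramR 1 1 ≠ 0` (§2).  With §3: the K1-a♮ row instance writes
`… σ (cornerTrace_ne_zero L e dV hdV hdV0 dW hdW hdW0 hσ0 (complexConj_eq_neg_of_single_mem_skewMatrices L e dV hdV hdV0 dW hdW hdW0 hskew))` with NO by-value letter left on `hτ`.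
[cite: HarrisKudlaSweet1996, §1 (1.11)–(1.12)] [cite: Shimura1997, §18.1 (18.4)] -/
theorem complexConj_eq_neg_of_single_mem_skewMatrices {σ : L}
    (hskew : Matrix.single (1 : Fin 2) (1 : Fin 2) σ ∈
      skewMatrices ((IsCMField.complexConj L : L ≃ₐ[Fp L] L) : L →+* L) ((gramR L e dV hdV dW hdW).map (algebraMap (Fp L) L))) :
    IsCMField.complexConj L σ = -σ := by
  rw [mem_skewMatrices_iff] at hskew
  have h11 := congrArg (fun X : Matrix (Fin 2) (Fin 2) L => X 1 1) hskew
  simp only [Matrix.add_apply, Matrix.zero_apply, Matrix.mul_apply, Fin.sum_univ_two, Matrix.transpose_apply, Matrix.map_apply, Matrix.single_apply,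
    gramR_eq_diagonal, Matrix.diagonal_apply] at h11
  simp only [Fin.isValue, one_ne_zero, and_true, ↓reduceIte, and_self, map_zero, mul_zero, zero_mul, zero_add, RingHom.coe_coe] at h11
  -- `h11 : ι(t₁) * σ + c σ * ι(t₁) = 0`
  have ht : (algebraMap (Fp L) L) (gramR L e dV hdV dW hdW 1 1) ≠ 0 :=
    (map_ne_zero _).2 (gramR_apply_ne_zero L e dV hdV hdV0 dW hdW hdW0 1)
  rw [gramR_eq_diagonal, Matrix.diagonal_apply_eq] at ht
  have hsum : (σ + IsCMField.complexConj L σ) * (algebraMap (Fp L) L) ((⟨dV (e.symm 1).1, (IsCMField.complexConj_eq_self_iff (K := L) (dV (e.symm 1).1)).1 (hdV _)⟩ : Fp L) *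
      ⟨dW (e.symm 1).2, (IsCMField.complexConj_eq_self_iff (K := L) (dW (e.symm 1).2)).1 (hdW _)⟩) = 0 := by
    rw [add_mul, mul_comm σ]
    exact h11
  exact eq_neg_of_add_eq_zero_right ((mul_eq_zero.1 hsum).resolve_right ht)

end Skew

end Summit.HodgeConjecture.HodgeConjecture.Cruxes.HLiu418.K2LiuKindOneSingularCornerTraceLetter

end
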